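import Summits.CriticalPhenomena.PercolationContinuityZ3.Theorems.PercNearOneGluingNoHeavyLowerTailPivotalBHKRowPrelim
import Mathlib.Tactic.Linarith
import Mathlib.Tactic.Ring
import HarnessLib

/-!
# `NoHeavyLowerTail` (stmt-CriticalPhenomena-4575) — the BHK row of the pivotal refinement, kernel form, II:
# `q · T_a ≤ u_b · u_c` on EVERY finite weighted graph (any support `D`, any weights `p ∈ [0,1]`)

Support file (prover prim-gen-kcluster gen 43; `--supports stmt-CriticalPhenomena-4575`).  No named facts, no sorries, no definitions
(the `a`-star functional `C ↦ PrW_Da{S | some s(a,y) ∈ S with y = x or y covered by C}` is written inline).  Part I (`…PivotalBHKRowPrelim.lean`) has the finitary two-functional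
BHK inequality `PivotalBHK.bhk14_two_ED`, the dictionary lemmas `ind_Ta_union` / `ind_Uc_union` / `ind_Q_union` and the independence
`PrW_starHit_inter`.

Three-point cells of the finitary weighted cube `PrW D p` (coordinates = the pairs `D`, terminals `a b c`):
`q = P(a|b|c) = PrW((conn a b)ᶜ ∩ (conn a c)ᶜ ∩ (conn b c)ᶜ)`, `u_b = P(ac|b) = PrW(conn a c ∩ (conn a b)ᶜ)`,
`u_c = P(ab|c) = PrW(conn a b ∩ (conn a c)ᶜ)`, and the PIVOTAL cell `T_a = n_a = P(abc ∧ b ≁ c once the pairs at a are closed)`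
(`conn a b ∩ conn a c ∩ pivEv a b c`; prim-ineq-gen-2's `n`, prim-cert-2's `ThreePointGamma.pivEv`).

**Theorem (BHK row, `bhkRow_PrW`).**  For `a ≠ b`, `a ≠ c`:  `q · n_a ≤ u_b · u_c`.

This is the percolation-law form of van den Berg–Häggström–Kahn's Theorem 1.4 [cite: VandenbergHaggstromKahn2005, Thm. 1.4 (p. 7)
and eq. (2) (p. 2)] ("given `s ↮ t`, increasing functions of `C_s` and of `C_t` are negatively correlated"), applied on the
coordinates `D ∖ touch{a}` (the world without the pairs at `a`) to the two increasing cluster functionals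
`F(C_b) = P(some open pair at a lands in C_b)`, `G(C_c) = P(some open pair at a lands in C_c)`: integrating out the pairs
at `a` (block Fubini `DualBHK.PrW_union_eq_sum`), `T_a = E[1{b↮c} F G]`, `u_c = E[1{b↮c} F (1−G)]`, `u_b = E[1{b↮c} (1−F) G]`,
`q = E[1{b↮c}(1−F)(1−G)]` — products because, given `b ↮ c` off `a`, the `a`-stars into the two clusters are disjoint sets of
coordinates (`PrW_starHit_inter`) — and then `u_b u_c − q T_a = E[1{b↮c}F]·E[1{b↮c}G] − E[1{b↮c}]·E[1{b↮c}FG] ≥ 0` is exactly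
Theorem 1.4 (tree: `BHK2006_twoSetConditionalAssociation.negCorrelation`, Literature, proved; finitary form `bhk14_two_ED`).
In the law-level files of the cubic programme this row is the hypothesis `0 ≤ SBHK` (`CubicThreePointApex.SBHK`, "[folklore] BHK 2006
Thm 1.4"); here it is a kernel theorem in the route's `PrW` vocabulary, next to its dual `DualBHK.dualBHK` (`t · n′_a ≤ u_b · u_c`).
Context (prim-gen-kcluster gen 43, KCLUSTER-gen43.md): with `T₀ := t − T_a − T_b − T_c` the coarse atoms
`(T₀, T_a, T_b, T_c, u_a, u_b, u_c, q)` are the joint law of the three increasing events `{a~b off c}`, `{a~c off b}`, `{b~c off a}`;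
this row says that the last two are NEGATIVELY correlated given the failure of the first; the conjectural dual rows dR3/dR4 of that
memo concern the conditioning on its success.
-/

noncomputable section

namespace Summit.CriticalPhenomena.PercolationContinuityZ3.Theorems

namespace PivotalBHK

open Finset MeasureTheory Literature.Probability.Percolation Literature.Probability.Percolation.DecisionTree
open Literature.Probability.LatticeModels (prodBernoulli)
open Gladkov ThreePointGamma CovTauStarN ThreePointLB
open scoped Classical

variable {V : Type*} [Fintype V] [DecidableEq V]

/-! ### The star functionals and the cell identities; THEOREM -/

section Main

variable {ι : Type*} [DecidableEq ι]

omit [Fintype V] [DecidableEq V] in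
/-- `ED` of `α (1−β)(1−γ)` expanded. [folklore] -/
theorem ED_expand_nn (D : Finset ι) (p : ι → ℝ) (α β γ : Finset ι → ℝ) :
    ED D p (fun K => α K * ((1 - β K) * (1 - γ K))) =
      ED D p α - ED D p (fun K => α K * β K) - ED D p (fun K => α K * γ K) + ED D p (fun K => α K * (β K * γ K)) := by
  unfold ED
  rw [← Finset.sum_sub_distrib, ← Finset.sum_sub_distrib, ← Finset.sum_add_distrib]
  exact Finset.sum_congr rfl fun K _ => by ring

omit [Fintype V] [DecidableEq V] in
/-- `ED` of `α β (1−γ)` expanded. [folklore] -/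
theorem ED_expand_pn (D : Finset ι) (p : ι → ℝ) (α β γ : Finset ι → ℝ) :
    ED D p (fun K => α K * (β K * (1 - γ K))) = ED D p (fun K => α K * β K) - ED D p (fun K => α K * (β K * γ K)) := by
  unfold ED
  rw [← Finset.sum_sub_distrib]
  exact Finset.sum_congr rfl fun K _ => by ring

omit [Fintype V] [DecidableEq V] in
/-- `ED` of `α (1−β) γ` expanded. [folklore] -/
theorem ED_expand_np (D : Finset ι) (p : ι → ℝ) (α β γ : Finset ι → ℝ) :
    ED D p (fun K => α K * ((1 - β K) * γ K)) = ED D p (fun K => α K * γ K) - ED D p (fun K => α K * (β K * γ K)) := by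
  unfold ED
  rw [← Finset.sum_sub_distrib]
  exact Finset.sum_congr rfl fun K _ => by ring

variable (Da : Finset (Sym2 V)) {p : Sym2 V → ℝ} (hp0 : ∀ e, 0 ≤ p e) (hp1 : ∀ e, p e ≤ 1)

omit [Fintype V] in
include hp0 hp1 in
/-- The star functional is increasing in the edge set. [this work] -/
theorem starFun_mono (a x : V) : Monotone ((fun C : Set (Sym2 V) => PrW Da p {S | ∃ y, (y = x ∨ ∃ e ∈ C, y ∈ e) ∧ s(a, y) ∈ S})) := by
  intro C C' hCC'
  refine PrW_mono Da hp0 hp1 fun S _ hS => ?_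
  obtain ⟨y, hy, hyS⟩ := hS
  exact ⟨y, hy.imp id (fun ⟨e, he, hye⟩ => ⟨e, hCC' he, hye⟩), hyS⟩

/-- On a configuration, the star functional of the cluster of `x` is the mass of `starHit a x`. [this work] -/
theorem fcl_starFun (a x : V) (K : Finset (Sym2 V)) : fcl ((fun C : Set (Sym2 V) => PrW Da p {S | ∃ y, (y = x ∨ ∃ e ∈ C, y ∈ e) ∧ s(a, y) ∈ S})) x K = PrW Da p ({S : Finset (Sym2 V) | ∃ y ∈ cl K x, s(a, y) ∈ S}) := by
  unfold fcl
  simp only []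
  refine PrW_congr_set Da p fun L _ => ?_
  simp only [Set.mem_setOf_eq]
  constructor
  · rintro ⟨y, hy, hL⟩
    exact ⟨y, mem_cl.2 ((reachable_iff_exists_mem_openEdgeCluster _ x y).2 hy), hL⟩
  · rintro ⟨y, hy, hL⟩
    exact ⟨y, (reachable_iff_exists_mem_openEdgeCluster _ x y).1 (mem_cl.1 hy), hL⟩

variable (D : Finset (Sym2 V)) {a b c : V}
include hp0 hp1

/-- **THEOREM (BHK row of the pivotal refinement, kernel form).**  On the coordinates `D` with weights `p ∈ [0,1]`, for
`a ≠ b`, `a ≠ c`:  `P(a|b|c) · P(abc ∧ a pivotal) ≤ P(ac|b) · P(ab|c)`, i.e. `q · n_a ≤ u_b · u_c`.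
[cite: VandenbergHaggstromKahn2005, Thm. 1.4 (p. 7), eq. (2) (p. 2)] (there: `C_s`, `C_t` negatively correlated given `s ↮ t`;
here applied off the pairs at `a` to the two `a`-star functionals, see the module docstring). -/
theorem bhkRow_PrW (hab : a ≠ b) (hac : a ≠ c) :
    PrW D p ((conn a b)ᶜ ∩ (conn a c)ᶜ ∩ (conn b c)ᶜ) * PrW D p (conn a b ∩ conn a c ∩ pivEv a b c) ≤
      PrW D p (conn a c ∩ (conn a b)ᶜ) * PrW D p (conn a b ∩ (conn a c)ᶜ) := by
  have hba : b ≠ a := fun h => hab h.symm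
  have hca : c ≠ a := fun h => hac h.symm
  set D' := D \ touch {a} with hD'
  set Da := D ∩ touch {a} with hDa
  have hD : D' ∪ Da = D := Finset.sdiff_union_inter D (touch {a})
  have hdisj : Disjoint D' Da := Finset.disjoint_sdiff_inter D (touch {a})
  have offA : ∀ {K : Finset (Sym2 V)}, K ∈ D'.powerset → ∀ e ∈ K, a ∉ e := by
    intro K hK e he hae
    have := (Finset.mem_sdiff.1 (Finset.mem_powerset.1 hK he)).2
    exact this (mem_touch.2 ⟨a, Finset.mem_singleton_self a, hae⟩)
  have atA : ∀ {R : Finset (Sym2 V)}, R ∈ Da.powerset → ∀ e ∈ R, a ∈ e := by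
    intro R hR e he
    obtain ⟨v, hv, hve⟩ := mem_touch.1 (Finset.mem_inter.1 (Finset.mem_powerset.1 hR he)).2
    rwa [Finset.mem_singleton.1 hv] at hve
  set Ψ := (fun C : Set (Sym2 V) => PrW Da p {S | ∃ y, (y = b ∨ ∃ e ∈ C, y ∈ e) ∧ s(a, y) ∈ S}) with hΨ
  set Φ := (fun C : Set (Sym2 V) => PrW Da p {S | ∃ y, (y = c ∨ ∃ e ∈ C, y ∈ e) ∧ s(a, y) ∈ S}) with hΦ
  set f : Finset (Sym2 V) → ℝ := fun K => PrW Da p ({S : Finset (Sym2 V) | ∃ y ∈ cl K b, s(a, y) ∈ S}) with hf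
  set g : Finset (Sym2 V) → ℝ := fun K => PrW Da p ({S : Finset (Sym2 V) | ∃ y ∈ cl K c, s(a, y) ∈ S}) with hg
  have hfK : ∀ K, fcl Ψ b K = f K := fun K => fcl_starFun Da a b K
  have hgK : ∀ K, fcl Φ c K = g K := fun K => fcl_starFun Da a c K
  -- inner integrations over the pairs at `a`
  have h0 : ∀ {K : Finset (Sym2 V)}, c ∈ cl K b → 1 - hr b c K = 0 := fun h => by rw [hr_eq_ite, if_pos h]; ring
  have h1 : ∀ {K : Finset (Sym2 V)}, c ∉ cl K b → 1 - hr b c K = 1 := fun h => by rw [hr_eq_ite, if_neg h]; ring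
  have inner_T : ∀ K ∈ D'.powerset, ∑ R ∈ Da.powerset, wtW Da p R * ind (conn a b ∩ conn a c ∩ pivEv a b c) (K ∪ R) =
      (1 - hr b c K) * (f K * g K) := by
    intro K hK'
    have hK := offA hK'
    by_cases hcb : c ∈ cl K b
    · rw [h0 hcb, zero_mul]
      refine Finset.sum_eq_zero fun R hR => ?_
      rw [ind_Ta_union hK (atA hR) hba hca, h0 hcb]; ring
    · rw [h1 hcb, one_mul]
      calc ∑ R ∈ Da.powerset, wtW Da p R * ind (conn a b ∩ conn a c ∩ pivEv a b c) (K ∪ R)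
          = ∑ R ∈ Da.powerset, wtW Da p R * ind ({S : Finset (Sym2 V) | ∃ y ∈ cl K b, s(a, y) ∈ S} ∩ {S : Finset (Sym2 V) | ∃ y ∈ cl K c, s(a, y) ∈ S}) R :=
            Finset.sum_congr rfl fun R hR => by
              rw [ind_Ta_union hK (atA hR) hba hca, h1 hcb, one_mul, BHK2006.ind_inter]
        _ = PrW Da p ({S : Finset (Sym2 V) | ∃ y ∈ cl K b, s(a, y) ∈ S} ∩ {S : Finset (Sym2 V) | ∃ y ∈ cl K c, s(a, y) ∈ S}) := (PrW_eq_sum_ind _ _ _).symm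
        _ = f K * g K := PrW_starHit_inter Da p K hK hba hcb
  have inner_Uc : ∀ K ∈ D'.powerset, ∑ R ∈ Da.powerset, wtW Da p R * ind (conn a b ∩ (conn a c)ᶜ) (K ∪ R) =
      (1 - hr b c K) * (f K * (1 - g K)) := by
    intro K hK'
    have hK := offA hK'
    by_cases hcb : c ∈ cl K b
    · rw [h0 hcb, zero_mul]
      refine Finset.sum_eq_zero fun R hR => ?_
      rw [ind_Uc_union hK (atA hR) hba hca, h0 hcb]; ring
    · rw [h1 hcb, one_mul]
      calc ∑ R ∈ Da.powerset, wtW Da p R * ind (conn a b ∩ (conn a c)ᶜ) (K ∪ R)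
          = ∑ R ∈ Da.powerset, (wtW Da p R * ind ({S : Finset (Sym2 V) | ∃ y ∈ cl K b, s(a, y) ∈ S}) R - wtW Da p R * ind ({S : Finset (Sym2 V) | ∃ y ∈ cl K b, s(a, y) ∈ S} ∩ {S : Finset (Sym2 V) | ∃ y ∈ cl K c, s(a, y) ∈ S}) R) :=
            Finset.sum_congr rfl fun R hR => by
              rw [ind_Uc_union hK (atA hR) hba hca, h1 hcb, one_mul, BHK2006.ind_inter]; ring
        _ = PrW Da p ({S : Finset (Sym2 V) | ∃ y ∈ cl K b, s(a, y) ∈ S}) - PrW Da p ({S : Finset (Sym2 V) | ∃ y ∈ cl K b, s(a, y) ∈ S} ∩ {S : Finset (Sym2 V) | ∃ y ∈ cl K c, s(a, y) ∈ S}) := by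
            rw [Finset.sum_sub_distrib, ← PrW_eq_sum_ind, ← PrW_eq_sum_ind]
        _ = f K * (1 - g K) := by rw [PrW_starHit_inter Da p K hK hba hcb]; ring
  have inner_Ub : ∀ K ∈ D'.powerset, ∑ R ∈ Da.powerset, wtW Da p R * ind (conn a c ∩ (conn a b)ᶜ) (K ∪ R) =
      (1 - hr b c K) * ((1 - f K) * g K) := by
    intro K hK'
    have hK := offA hK'
    -- `ac|b` is `ab|c` with `b` and `c` exchanged
    by_cases hcb : c ∈ cl K b
    · have hbc : b ∈ cl K c := mem_cl_comm.1 hcb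
      rw [h0 hcb, zero_mul]
      refine Finset.sum_eq_zero fun R hR => ?_
      rw [ind_Uc_union hK (atA hR) hca hba, hr_eq_ite, if_pos hbc]; ring
    · have hbc : b ∉ cl K c := fun h => hcb (mem_cl_comm.1 h)
      rw [h1 hcb, one_mul]
      calc ∑ R ∈ Da.powerset, wtW Da p R * ind (conn a c ∩ (conn a b)ᶜ) (K ∪ R)
          = ∑ R ∈ Da.powerset, (wtW Da p R * ind ({S : Finset (Sym2 V) | ∃ y ∈ cl K c, s(a, y) ∈ S}) R - wtW Da p R * ind ({S : Finset (Sym2 V) | ∃ y ∈ cl K b, s(a, y) ∈ S} ∩ {S : Finset (Sym2 V) | ∃ y ∈ cl K c, s(a, y) ∈ S}) R) :=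
            Finset.sum_congr rfl fun R hR => by
              rw [ind_Uc_union hK (atA hR) hca hba, hr_eq_ite, if_neg hbc, sub_zero, one_mul, BHK2006.ind_inter]; ring
        _ = PrW Da p ({S : Finset (Sym2 V) | ∃ y ∈ cl K c, s(a, y) ∈ S}) - PrW Da p ({S : Finset (Sym2 V) | ∃ y ∈ cl K b, s(a, y) ∈ S} ∩ {S : Finset (Sym2 V) | ∃ y ∈ cl K c, s(a, y) ∈ S}) := by
            rw [Finset.sum_sub_distrib, ← PrW_eq_sum_ind, ← PrW_eq_sum_ind]
        _ = (1 - f K) * g K := by rw [PrW_starHit_inter Da p K hK hba hcb]; ring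
  have inner_Q : ∀ K ∈ D'.powerset, ∑ R ∈ Da.powerset, wtW Da p R * ind ((conn a b)ᶜ ∩ (conn a c)ᶜ ∩ (conn b c)ᶜ) (K ∪ R) =
      (1 - hr b c K) * ((1 - f K) * (1 - g K)) := by
    intro K hK'
    have hK := offA hK'
    by_cases hcb : c ∈ cl K b
    · rw [h0 hcb, zero_mul]
      refine Finset.sum_eq_zero fun R hR => ?_
      rw [ind_Q_union hK (atA hR) hba hca, h0 hcb]; ring
    · rw [h1 hcb, one_mul]
      calc ∑ R ∈ Da.powerset, wtW Da p R * ind ((conn a b)ᶜ ∩ (conn a c)ᶜ ∩ (conn b c)ᶜ) (K ∪ R)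
          = ∑ R ∈ Da.powerset, (wtW Da p R - wtW Da p R * ind ({S : Finset (Sym2 V) | ∃ y ∈ cl K b, s(a, y) ∈ S}) R - wtW Da p R * ind ({S : Finset (Sym2 V) | ∃ y ∈ cl K c, s(a, y) ∈ S}) R +
              wtW Da p R * ind ({S : Finset (Sym2 V) | ∃ y ∈ cl K b, s(a, y) ∈ S} ∩ {S : Finset (Sym2 V) | ∃ y ∈ cl K c, s(a, y) ∈ S}) R) :=
            Finset.sum_congr rfl fun R hR => by
              rw [ind_Q_union hK (atA hR) hba hca, h1 hcb, one_mul, BHK2006.ind_inter]; ring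
        _ = 1 - PrW Da p ({S : Finset (Sym2 V) | ∃ y ∈ cl K b, s(a, y) ∈ S}) - PrW Da p ({S : Finset (Sym2 V) | ∃ y ∈ cl K c, s(a, y) ∈ S}) + PrW Da p ({S : Finset (Sym2 V) | ∃ y ∈ cl K b, s(a, y) ∈ S} ∩ {S : Finset (Sym2 V) | ∃ y ∈ cl K c, s(a, y) ∈ S}) := by
            rw [Finset.sum_add_distrib, Finset.sum_sub_distrib, Finset.sum_sub_distrib, ← PrW_eq_sum_ind, ← PrW_eq_sum_ind,
              ← PrW_eq_sum_ind, sum_wtW]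
        _ = (1 - f K) * (1 - g K) := by rw [PrW_starHit_inter Da p K hK hba hcb]; ring
  -- the four masses as expectations on `D'`
  have cell : ∀ (X : Set (Finset (Sym2 V))) (φ : Finset (Sym2 V) → ℝ),
      (∀ K ∈ D'.powerset, ∑ R ∈ Da.powerset, wtW Da p R * ind X (K ∪ R) = φ K) → PrW D p X = ED D' p φ := by
    intro X φ hφ
    rw [← hD, DualBHK.PrW_union_eq_sum hdisj]
    unfold ED
    exact Finset.sum_congr rfl fun K hK => by rw [hφ K hK]
  have eT := cell _ _ inner_T
  have eUc := cell _ _ inner_Uc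
  have eUb := cell _ _ inner_Ub
  have eQ := cell _ _ inner_Q
  rw [eT, eUc, eUb, eQ, ED_expand_nn, ED_expand_pn, ED_expand_np]
  -- BHK Theorem 1.4 for the two star functionals
  have key := bhk14_two_ED D' hp0 hp1 b c Ψ Φ (starFun_mono Da hp0 hp1 a b) (starFun_mono Da hp0 hp1 a c)
  have k1 : ED D' p (fun K => (1 - hr b c K) * (fcl Ψ b K * fcl Φ c K)) = ED D' p (fun K => (1 - hr b c K) * (f K * g K)) :=
    ED_congr_on D' p fun K _ => by rw [hfK, hgK]
  have k2 : ED D' p (fun K => (1 - hr b c K) * fcl Ψ b K) = ED D' p (fun K => (1 - hr b c K) * f K) :=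
    ED_congr_on D' p fun K _ => by rw [hfK]
  have k3 : ED D' p (fun K => (1 - hr b c K) * fcl Φ c K) = ED D' p (fun K => (1 - hr b c K) * g K) :=
    ED_congr_on D' p fun K _ => by rw [hgK]
  rw [k1, k2, k3] at key
  nlinarith [key]

end Main

end PivotalBHK

end Summit.CriticalPhenomena.PercolationContinuityZ3.Theorems

end
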